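import Summits.BirchSwinnertonDyer.Rank1Residual.AdditivePotMult.QuadraticBaseChangeRegulatorRankOne
import Summits.BirchSwinnertonDyer.Rank1Residual.AdditivePotMult.QuadraticBaseChangeDescentOrdp
import Summits.BirchSwinnertonDyer.Rank1Residual.AdditivePotMult.QuadraticBaseChangeMilneQuotientOddPart
import HarnessLib

/-!
# Milne's quotient with ARCHIMEDEAN and REGULATOR factors: an explicit rational times
# `RHS(W)·RHS(Wd)`, `v_p = 0` iff the odd Tamagawa identity; and `hWR_p` in TOTAL RANK ONE over an
# imaginary quadratic field (row T-MIL-R1, FILE E-2; seat n1011-p01 GEN 7)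

HONEST FRAMING (cell `b2b-bsdres`, run/shared/lean/b2b/bsd-rank1-residual/, verbatim in every
file): the goal of the cell is to DELETE the COMBINATION-SHAPED residual classes of the
Birch–Swinnerton-Dyer formula for ALL analytic-rank `≤ 1` elliptic curves over `ℚ` — "full BSD
formula for every rank `≤ 1` curve in class `C`" assembled STRICTLY from published theorems — so
that the rank-`≤ 1` remainder becomes exactly the CONSTRUCTION-SHAPED classes, which are TYPED
(missing-input `Prop`s), NOT attempted. This is not "finishing BSD". Sub-classes X3♯(M) / X4(M)
(additive, potentially multiplicative prime; base-change-and-descend): a RESEARCH ROUTE; they stay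
CONSTRUCTION-SHAPED; nothing is booked by this file; no mark / label moved. THEOREMS ONLY: no
definition, no named fact, no `sorry`.

## What (row T-MIL-R1, `cells/n1011/skel/T-MIL-R1.md` §1 (Q), FILE E-2)

The positive-rank, signature-agnostic twin of FILE C-4a §2–§3 (`QuadraticBaseChangeMilneQuotientOddPart`:
rank zero over an imaginary `K`, all regulators `1`, `#tors = #E`). The two pieces of Milne's
quotient that depend on the rank of `W'(K)` and on the signature of `K` enter as HYPOTHESES with
natural-number factors `n`, `m`:
`hA : Ω(W)·Ω(W^{(d_K)}) = n · Ω(W_K/K)` (archimedean: `n = n_W ∈ {1,2}` for `K` imaginary — tree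
`realPeriod_mul_realPeriod_quadraticTwist_eq_mul_bsdPeriod`; `n = 1` for `K` real, not yet in the
tree) and `hm : m · Reg(W') = 2 · Reg(W) · Reg(Wd)` (regulators: `m = 2` in rank zero; `m ∈ {1,4}`
in total rank one — FILE E-1 `exists_mul_regulator_baseChange_quadratic_of_rank_add_eq_one`).

* `milneQuotient_mul_eq_of_arch_of_regulator` — **Milne's quotient cross-multiplied, ANY rank, ANY
  quadratic `K`, given `hA`, `hm`**:
  `Q · (n·|u_d|·#Ш(W)·#Ш(Wd)·∏c(W)·∏c(Wd)·#W'(K)_tors²·m) = (|N u'|·#Ш(W')·∏c_w(W')·#W_tors²·#Wd_tors²·2) · RHS(W)·RHS(Wd)`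
  — C-4a's period elimination (`bsdPeriod_smul'`, `realPeriodRat_smul_holds`) run with `hA`, `hm`;
* `milneQuotient_eq_ratio_mul_of_arch_of_regulator` — hence `Q = q₁ · RHS(W)·RHS(Wd)` with the
  explicit rational `q₁` (`Ш(W)`, `Ш(Wd)` finite, `n, m ≠ 0`);
* `padicValRat_milneRatio_eq_zero_iff` — **at odd `p` with `v_p(n) = v_p(m) = 0`: `v_p(q₁) = 0` IFF
  `v_p(|N u'|·∏c_w(W')) = v_p(|u_d|·∏c(W)·∏c(Wd))`** (torsion and `Ш` orders balance at odd `p`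
  in ANY rank: FILE E-1);
* `milneQuotient_ordp_of_tamagawa_of_arch_of_regulator` — `hWR_p` (C-4a's displayed shape) from
  the odd Tamagawa identity, given `hA`, `hm` with `p`-adic-unit factors;
* `milneQuotient_ordp_of_tamagawa_of_rank_add_eq_one` — **IMAGINARY `K`, TOTAL RANK ONE**: `hWR_p`
  from the odd Tamagawa identity when `rank W(ℚ) + rank Wd(ℚ) = 1` (`n = n_W`, `m` from E-1) —
  the schema FILE E-3 instantiates with the ENDs #2 / #3 and composes with D-2's
  `bsdp_of_pPartOver_of_bsdp_twist_ordp`.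

HONEST LIMITS: the real-`K` archimedean identity (`n = 1`) is NOT in the tree (the imaginary one
is); total rank `≥ 2` has no `hm` in the tree; odd `p`; TOOL theorems; closes no class; moves no
mark; A65 is not consumed and not discharged (the real identity `hWR` is not claimed).

References: J. S. Milne, Invent. Math. 17 (1972) §1 Thm. 1, §2 [Milne1972ArithmeticAV];
T. Dokchitser, V. Dokchitser, Ann. of Math. 172 (2010) §2.1, Lemma 4.14
[DokchitserDokchitserAnnals2010]; B. Gross, D. Zagier, Invent. Math. 84 (1986) V.§2
[GrossZagier1986]; D. Jetchev, C. Skinner, X. Wan, Camb. J. Math. 5 (2017) §7.4.1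
[JetchevSkinnerWan2017].
-/

noncomputable section

open scoped Classical NumberField

open WeierstrassCurve NumberField Literature.NumberTheory.EllipticCurves
  Literature.NumberTheory.QuadraticFields

namespace Summit.BirchSwinnertonDyer.Rank1Residual.AdditivePotMult

/-! ## §1 Any rank, any signature: the quotient given the archimedean and regulator factors -/

section General

variable (W : WeierstrassCurve ℚ) [W.IsElliptic] (K : Type) [Field K] [NumberField K]
  (Wd : WeierstrassCurve ℚ) [Wd.IsElliptic] (W' : WeierstrassCurve K) [W'.IsElliptic]

/-- **Milne's quotient cross-multiplied, ANY rank, ANY quadratic `K`, given the archimedean factor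
`hA : Ω(W)·Ω(W^{(d_K)}) = n·Ω(W_K)` and the regulator factor `hm : m·Reg(W') = 2·Reg(W)·Reg(Wd)`**
(`W_d = C_d • W^{(d_K)}`, `W' = C' • W_K`):
`[#Ш(W')·Reg(W')·Ω(W')·∏c_w(W')/#W'(K)_tors²] · (n·|u_d|·#Ш(W)·#Ш(W_d)·∏c(W)·∏c(W_d)·#W'(K)_tors²·m)
 = (|N_{K/ℚ}(u')|·#Ш(W')·∏c_w(W')·#W(ℚ)_tors²·#W_d(ℚ)_tors²·2) · RHS(W)·RHS(W_d)` in `ℝ`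
(`bsdPeriod_smul'`: `Ω(C' • W_K) = |N(u')|·Ω(W_K)`; `realPeriodRat_smul_holds`:
`Ω(C_d • W^{(D)}) = |u_d|·Ω(W^{(D)})`). No finiteness needed.
[cite: Milne1972ArithmeticAV, §1 Thm. 1 and §2 (through DokchitserDokchitserAnnals2010, §2.1, proof of Thm. 8)] -/
theorem milneQuotient_mul_eq_of_arch_of_regulator
    {Cd : VariableChange ℚ} (hWd : Cd • W.quadraticTwist (NumberField.discr K : ℚ) = Wd)
    {C' : VariableChange K} (hW' : C' • W.baseChange K = W') {n m : ℕ}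
    (hA : W.realPeriodRat * (W.quadraticTwist (NumberField.discr K : ℚ)).realPeriodRat =
      (n : ℝ) * (W.baseChange K).bsdPeriod)
    (hm : (m : ℝ) * W'.regulator = 2 * W.regulator * Wd.regulator) :
    (W'.shaOrder : ℝ) * W'.regulator * W'.bsdPeriod * (W'.tamagawaProduct : ℝ) /
          (W'.torsionOrder : ℝ) ^ 2 *
        ((n * |(Cd.u : ℚ)| * W.shaOrder * Wd.shaOrder *
          W.tamagawaProduct * Wd.tamagawaProduct * W'.torsionOrder ^ 2 * m : ℚ) : ℝ) =
      ((|Algebra.norm ℚ (C'.u : K)| * W'.shaOrder * W'.tamagawaProduct *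
          W.torsionOrder ^ 2 * Wd.torsionOrder ^ 2 * 2 : ℚ) : ℝ) *
        (W.bsdRHS * Wd.bsdRHS) := by
  have hD : (NumberField.discr K : ℚ) ≠ 0 := by exact_mod_cast NumberField.discr_ne_zero K
  haveI := W.isElliptic_quadraticTwist hD
  subst hWd hW'
  haveI hEK : (W.baseChange K).IsElliptic := by rw [baseChange]; infer_instance
  set P : ℝ := (W.baseChange K).bsdPeriod with hP_def
  have hP' : (C' • W.baseChange K).bsdPeriod = ((|Algebra.norm ℚ (C'.u : K)| : ℚ) : ℝ) * P :=
    (W.baseChange K).bsdPeriod_smul' C'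
  have hΩd : (Cd • W.quadraticTwist (NumberField.discr K : ℚ)).realPeriodRat =
      |((Cd.u : ℚ) : ℝ)| * (W.quadraticTwist (NumberField.discr K : ℚ)).realPeriodRat :=
    (W.quadraticTwist (NumberField.discr K : ℚ)).realPeriodRat_smul_holds Cd
  have ht' : ((C' • W.baseChange K).torsionOrder : ℝ) ≠ 0 := by
    exact_mod_cast (C' • W.baseChange K).torsionOrder_pos_holds.ne'
  have ht : (W.torsionOrder : ℝ) ≠ 0 := by exact_mod_cast W.torsionOrder_pos_holds.ne'
  have htd : ((Cd • W.quadraticTwist (NumberField.discr K : ℚ)).torsionOrder : ℝ) ≠ 0 := by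
    exact_mod_cast (Cd • W.quadraticTwist (NumberField.discr K : ℚ)).torsionOrder_pos_holds.ne'
  rw [W.bsdRHS_def, (Cd • W.quadraticTwist (NumberField.discr K : ℚ)).bsdRHS_def, hP', hΩd,
    div_mul_div_comm, ← mul_div_assoc, div_mul_eq_mul_div,
    div_eq_div_iff (pow_ne_zero 2 ht') (mul_ne_zero (pow_ne_zero 2 ht) (pow_ne_zero 2 htd))]
  push_cast
  linear_combination
    (((C' • W.baseChange K).shaOrder : ℝ) * |((Algebra.norm ℚ (C'.u : K) : ℚ) : ℝ)| *
      ((C' • W.baseChange K).tamagawaProduct : ℝ) * |((Cd.u : ℚ) : ℝ)| * (W.shaOrder : ℝ) *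
      ((Cd • W.quadraticTwist (NumberField.discr K : ℚ)).shaOrder : ℝ) * (W.tamagawaProduct : ℝ) *
      ((Cd • W.quadraticTwist (NumberField.discr K : ℚ)).tamagawaProduct : ℝ) *
      ((C' • W.baseChange K).torsionOrder : ℝ) ^ 2 * (W.torsionOrder : ℝ) ^ 2 *
      ((Cd • W.quadraticTwist (NumberField.discr K : ℚ)).torsionOrder : ℝ) ^ 2 * P * (n : ℝ)) * hm
    - (((C' • W.baseChange K).shaOrder : ℝ) * |((Algebra.norm ℚ (C'.u : K) : ℚ) : ℝ)| *
      ((C' • W.baseChange K).tamagawaProduct : ℝ) * |((Cd.u : ℚ) : ℝ)| * (W.shaOrder : ℝ) *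
      ((Cd • W.quadraticTwist (NumberField.discr K : ℚ)).shaOrder : ℝ) * (W.tamagawaProduct : ℝ) *
      ((Cd • W.quadraticTwist (NumberField.discr K : ℚ)).tamagawaProduct : ℝ) *
      ((C' • W.baseChange K).torsionOrder : ℝ) ^ 2 * (W.torsionOrder : ℝ) ^ 2 *
      ((Cd • W.quadraticTwist (NumberField.discr K : ℚ)).torsionOrder : ℝ) ^ 2 * 2 *
      W.regulator * (Cd • W.quadraticTwist (NumberField.discr K : ℚ)).regulator) * hA

/-- **Milne's quotient IS the explicit rational `q₁` times `RHS(W)·RHS(W_d)`**,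
`q₁ = (|N u'|·#Ш(W')·∏c_w(W')·#W_tors²·#Wd_tors²·2) / (n·|u_d|·#Ш(W)·#Ш(W_d)·∏c(W)·∏c(W_d)·#W'_tors²·m)`
(given `hA`, `hm`; `Ш(W)`, `Ш(W_d)` finite and `n, m ≠ 0`, so the denominator is non-zero).
[cite: Milne1972ArithmeticAV, §1 Thm. 1 and §2 (through DokchitserDokchitserAnnals2010, §2.1, proof of Thm. 8)] -/
theorem milneQuotient_eq_ratio_mul_of_arch_of_regulator
    {Cd : VariableChange ℚ} (hWd : Cd • W.quadraticTwist (NumberField.discr K : ℚ) = Wd)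
    {C' : VariableChange K} (hW' : C' • W.baseChange K = W') [Finite W.sha] [Finite Wd.sha]
    {n m : ℕ} (hn0 : n ≠ 0) (hm0 : m ≠ 0)
    (hA : W.realPeriodRat * (W.quadraticTwist (NumberField.discr K : ℚ)).realPeriodRat =
      (n : ℝ) * (W.baseChange K).bsdPeriod)
    (hm : (m : ℝ) * W'.regulator = 2 * W.regulator * Wd.regulator) :
    (W'.shaOrder : ℝ) * W'.regulator * W'.bsdPeriod * (W'.tamagawaProduct : ℝ) /
          (W'.torsionOrder : ℝ) ^ 2 =
      (((|Algebra.norm ℚ (C'.u : K)| * W'.shaOrder * W'.tamagawaProduct *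
            W.torsionOrder ^ 2 * Wd.torsionOrder ^ 2 * 2) /
          (n * |(Cd.u : ℚ)| * W.shaOrder * Wd.shaOrder *
            W.tamagawaProduct * Wd.tamagawaProduct * W'.torsionOrder ^ 2 * m) : ℚ) : ℝ) *
        (W.bsdRHS * Wd.bsdRHS) := by
  have h := milneQuotient_mul_eq_of_arch_of_regulator W K Wd W' hWd hW' hA hm
  have hB0 : ((n * |(Cd.u : ℚ)| * W.shaOrder * Wd.shaOrder *
      W.tamagawaProduct * Wd.tamagawaProduct * W'.torsionOrder ^ 2 * m : ℚ) : ℝ) ≠ 0 := by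
    have hn' : 0 < n := Nat.pos_of_ne_zero hn0
    have hud : (Cd.u : ℚ) ≠ 0 := (Cd.u).ne_zero
    have hS0 : 0 < W.shaOrder := W.shaOrder_pos ‹Finite W.sha›
    have hSd0 : 0 < Wd.shaOrder := Wd.shaOrder_pos ‹Finite Wd.sha›
    have hT0 : 0 < W.tamagawaProduct := W.tamagawaProduct_pos'
    have hTd0 : 0 < Wd.tamagawaProduct := Wd.tamagawaProduct_pos'
    have ht'0 : 0 < W'.torsionOrder := W'.torsionOrder_pos_holds
    have hm' : 0 < m := Nat.pos_of_ne_zero hm0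
    have : (n * |(Cd.u : ℚ)| * W.shaOrder * Wd.shaOrder *
        W.tamagawaProduct * Wd.tamagawaProduct * W'.torsionOrder ^ 2 * m : ℚ) ≠ 0 := by
      have hb : (|(Cd.u : ℚ)| : ℚ) ≠ 0 := abs_ne_zero.mpr hud
      positivity
    exact_mod_cast this
  rw [Rat.cast_div, div_mul_eq_mul_div, eq_div_iff hB0, ← h]

/-- **At an odd prime `p` with `v_p(n) = v_p(m) = 0`, `v_p(q₁) = 0` IFF the odd Tamagawa identity
holds** (ANY rank, any quadratic `K`; `Ш(W)`, `Ш(Wd)` finite): the `Ш`-orders and the torsion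
orders balance at odd `p` (FILE E-1: `padicValNat_shaOrder_baseChange_quadratic_of_odd_of_finite`,
`padicValNat_torsionOrder_baseChange_quadratic_of_odd`), and `n`, `m`, `2` are `p`-adic units;
what is left is `v_p(|N(u')|·∏c_w(W')) = v_p(|u_d|·∏c(W)·∏c(W_d))` — the body of `hodd`.
[cite: Milne1972ArithmeticAV, §1 Thm. 1 and §2 (through DokchitserDokchitserAnnals2010, §2.1, proof of Thm. 8 and Lemma 4.14)] -/
theorem padicValRat_milneRatio_eq_zero_iff (h2 : Module.finrank ℚ K = 2)
    {Cd : VariableChange ℚ} (hWd : Cd • W.quadraticTwist (NumberField.discr K : ℚ) = Wd)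
    {C' : VariableChange K} (hW' : C' • W.baseChange K = W') [Finite W.sha] [Finite Wd.sha]
    {n m : ℕ} (hn0 : n ≠ 0) (hm0 : m ≠ 0) (p : ℕ) [hp : Fact p.Prime] (hp2 : p ≠ 2)
    (hnv : padicValRat p (n : ℚ) = 0) (hmv : padicValRat p (m : ℚ) = 0) :
    padicValRat p (((|Algebra.norm ℚ (C'.u : K)| * W'.shaOrder * W'.tamagawaProduct *
            W.torsionOrder ^ 2 * Wd.torsionOrder ^ 2 * 2) /
          (n * |(Cd.u : ℚ)| * W.shaOrder * Wd.shaOrder *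
            W.tamagawaProduct * Wd.tamagawaProduct * W'.torsionOrder ^ 2 * m) : ℚ)) = 0 ↔
      padicValRat p (|Algebra.norm ℚ (C'.u : K)| * W'.tamagawaProduct : ℚ) =
        padicValRat p (|(Cd.u : ℚ)| * (W.tamagawaProduct * Wd.tamagawaProduct) : ℚ) := by
  have hsha : W'.ShaFinite :=
    shaFinite_baseChange_quadratic W K Wd W' h2 ⟨Cd, hWd⟩ ⟨C', hW'⟩ ‹Finite W.sha› ‹Finite Wd.sha›
  have hnorm : Algebra.norm ℚ (C'.u : K) ≠ 0 := Algebra.norm_ne_zero_iff.mpr (C'.u).ne_zero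
  have hud : (Cd.u : ℚ) ≠ 0 := (Cd.u).ne_zero
  have hS'0 : 0 < W'.shaOrder := W'.shaOrder_pos hsha
  have hS0 : 0 < W.shaOrder := W.shaOrder_pos ‹Finite W.sha›
  have hSd0 : 0 < Wd.shaOrder := Wd.shaOrder_pos ‹Finite Wd.sha›
  have hT'0 : 0 < W'.tamagawaProduct := W'.tamagawaProduct_pos'
  have hT0 : 0 < W.tamagawaProduct := W.tamagawaProduct_pos'
  have hTd0 : 0 < Wd.tamagawaProduct := Wd.tamagawaProduct_pos'
  have ht'0 : 0 < W'.torsionOrder := W'.torsionOrder_pos_holds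
  have ht0 : 0 < W.torsionOrder := W.torsionOrder_pos_holds
  have htd0 : 0 < Wd.torsionOrder := Wd.torsionOrder_pos_holds
  have ha : (|Algebra.norm ℚ (C'.u : K)| : ℚ) ≠ 0 := abs_ne_zero.mpr hnorm
  have hb : (|(Cd.u : ℚ)| : ℚ) ≠ 0 := abs_ne_zero.mpr hud
  have hS' : (W'.shaOrder : ℚ) ≠ 0 := by exact_mod_cast hS'0.ne'
  have hS : (W.shaOrder : ℚ) ≠ 0 := by exact_mod_cast hS0.ne'
  have hSd : (Wd.shaOrder : ℚ) ≠ 0 := by exact_mod_cast hSd0.ne'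
  have hT' : (W'.tamagawaProduct : ℚ) ≠ 0 := by exact_mod_cast hT'0.ne'
  have hT : (W.tamagawaProduct : ℚ) ≠ 0 := by exact_mod_cast hT0.ne'
  have hTd : (Wd.tamagawaProduct : ℚ) ≠ 0 := by exact_mod_cast hTd0.ne'
  have ht' : (W'.torsionOrder : ℚ) ≠ 0 := by exact_mod_cast ht'0.ne'
  have ht : (W.torsionOrder : ℚ) ≠ 0 := by exact_mod_cast ht0.ne'
  have htd : (Wd.torsionOrder : ℚ) ≠ 0 := by exact_mod_cast htd0.ne'
  have hn : (n : ℚ) ≠ 0 := by exact_mod_cast hn0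
  have hmq : (m : ℚ) ≠ 0 := by exact_mod_cast hm0
  have h2q : (2 : ℚ) ≠ 0 := two_ne_zero
  -- the `Ш`- and torsion orders balance at `p`
  have hTor : (padicValNat p W'.torsionOrder : ℤ) =
      padicValNat p W.torsionOrder + padicValNat p Wd.torsionOrder := by
    exact_mod_cast padicValNat_torsionOrder_baseChange_quadratic_of_odd W K h2 Wd ⟨Cd, hWd⟩ W'
      ⟨C', hW'⟩ p hp2
  have hSha : (padicValNat p W'.shaOrder : ℤ) =
      padicValNat p W.shaOrder + padicValNat p Wd.shaOrder := by
    exact_mod_cast padicValNat_shaOrder_baseChange_quadratic_of_odd_of_finite W K h2 Wd ⟨Cd, hWd⟩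
      W' ⟨C', hW'⟩ p hp2
  -- `2` is a `p`-adic unit
  haveI : Fact (Nat.Prime 2) := ⟨Nat.prime_two⟩
  have h2v : padicValRat p (2 : ℚ) = 0 := by
    rw [show (2 : ℚ) = ((2 : ℕ) : ℚ) by norm_num, padicValRat.of_nat, padicValNat_primes hp2,
      Nat.cast_zero]
  have hA : (|Algebra.norm ℚ (C'.u : K)| * W'.shaOrder * W'.tamagawaProduct *
      W.torsionOrder ^ 2 * Wd.torsionOrder ^ 2 * 2 : ℚ) ≠ 0 :=
    mul_ne_zero (mul_ne_zero (mul_ne_zero (mul_ne_zero (mul_ne_zero ha hS') hT')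
      (pow_ne_zero 2 ht)) (pow_ne_zero 2 htd)) h2q
  have hB : (n * |(Cd.u : ℚ)| * W.shaOrder * Wd.shaOrder *
      W.tamagawaProduct * Wd.tamagawaProduct * W'.torsionOrder ^ 2 * m : ℚ) ≠ 0 :=
    mul_ne_zero (mul_ne_zero (mul_ne_zero (mul_ne_zero (mul_ne_zero (mul_ne_zero
      (mul_ne_zero hn hb) hS) hSd) hT) hTd) (pow_ne_zero 2 ht')) hmq
  rw [padicValRat.div hA hB, sub_eq_zero,
    padicValRat.mul (mul_ne_zero (mul_ne_zero (mul_ne_zero (mul_ne_zero ha hS') hT')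
      (pow_ne_zero 2 ht)) (pow_ne_zero 2 htd)) h2q,
    padicValRat.mul (mul_ne_zero (mul_ne_zero (mul_ne_zero ha hS') hT') (pow_ne_zero 2 ht))
      (pow_ne_zero 2 htd),
    padicValRat.mul (mul_ne_zero (mul_ne_zero ha hS') hT') (pow_ne_zero 2 ht),
    padicValRat.mul (mul_ne_zero ha hS') hT', padicValRat.mul ha hS',
    padicValRat.mul (mul_ne_zero (mul_ne_zero (mul_ne_zero (mul_ne_zero (mul_ne_zero
      (mul_ne_zero hn hb) hS) hSd) hT) hTd) (pow_ne_zero 2 ht')) hmq,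
    padicValRat.mul (mul_ne_zero (mul_ne_zero (mul_ne_zero (mul_ne_zero (mul_ne_zero hn hb) hS)
      hSd) hT) hTd) (pow_ne_zero 2 ht'),
    padicValRat.mul (mul_ne_zero (mul_ne_zero (mul_ne_zero (mul_ne_zero hn hb) hS) hSd) hT) hTd,
    padicValRat.mul (mul_ne_zero (mul_ne_zero (mul_ne_zero hn hb) hS) hSd) hT,
    padicValRat.mul (mul_ne_zero (mul_ne_zero hn hb) hS) hSd,
    padicValRat.mul (mul_ne_zero hn hb) hS, padicValRat.mul hn hb,
    padicValRat.mul ha hT', padicValRat.mul hb (mul_ne_zero hT hTd), padicValRat.mul hT hTd,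
    padicValRat.pow, padicValRat.pow, padicValRat.pow, hnv, h2v, hmv,
    padicValRat.of_nat, padicValRat.of_nat, padicValRat.of_nat, padicValRat.of_nat,
    padicValRat.of_nat, padicValRat.of_nat, padicValRat.of_nat, padicValRat.of_nat,
    padicValRat.of_nat]
  constructor
  · intro h
    linear_combination h - hSha + 2 * hTor
  · intro h
    linear_combination h + hSha - 2 * hTor

/-- **`hWR_p` from the odd Tamagawa identity at `p`, ANY rank, ANY quadratic `K`, given the
archimedean factor `hA` and the regulator factor `hm` with `p`-adic units `n`, `m`** (`Ш(W)`,
`Ш(W_d)` finite, `p` odd): `q = q₁ > 0`, `v_p(q₁) = 0` (`padicValRat_milneRatio_eq_zero_iff`), and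
the identity (`milneQuotient_eq_ratio_mul_of_arch_of_regulator`). [cite: Milne1972ArithmeticAV, §1 Thm. 1 and §2 (through DokchitserDokchitserAnnals2010, §2.1, proof of Thm. 8)] -/
theorem milneQuotient_ordp_of_tamagawa_of_arch_of_regulator (h2 : Module.finrank ℚ K = 2)
    {Cd : VariableChange ℚ} (hWd : Cd • W.quadraticTwist (NumberField.discr K : ℚ) = Wd)
    {C' : VariableChange K} (hW' : C' • W.baseChange K = W') [Finite W.sha] [Finite Wd.sha]
    {n m : ℕ} (hn0 : n ≠ 0) (hm0 : m ≠ 0)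
    (hA : W.realPeriodRat * (W.quadraticTwist (NumberField.discr K : ℚ)).realPeriodRat =
      (n : ℝ) * (W.baseChange K).bsdPeriod)
    (hm : (m : ℝ) * W'.regulator = 2 * W.regulator * Wd.regulator)
    (p : ℕ) [hp : Fact p.Prime] (hp2 : p ≠ 2)
    (hnv : padicValRat p (n : ℚ) = 0) (hmv : padicValRat p (m : ℚ) = 0)
    (hT : padicValRat p (|Algebra.norm ℚ (C'.u : K)| * W'.tamagawaProduct : ℚ) =
      padicValRat p (|(Cd.u : ℚ)| * (W.tamagawaProduct * Wd.tamagawaProduct) : ℚ)) :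
    ∃ q : ℚ, 0 < q ∧ padicValRat p q = 0 ∧
      (W'.shaOrder : ℝ) * W'.regulator * W'.bsdPeriod * (W'.tamagawaProduct : ℝ) /
          (W'.torsionOrder : ℝ) ^ 2 = (q : ℝ) * (W.bsdRHS * Wd.bsdRHS) := by
  have hsha : W'.ShaFinite :=
    shaFinite_baseChange_quadratic W K Wd W' h2 ⟨Cd, hWd⟩ ⟨C', hW'⟩ ‹Finite W.sha› ‹Finite Wd.sha›
  refine ⟨_, ?_, (padicValRat_milneRatio_eq_zero_iff W K Wd W' h2 hWd hW' hn0 hm0 p hp2 hnv hmv).mpr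
    hT, milneQuotient_eq_ratio_mul_of_arch_of_regulator W K Wd W' hWd hW' hn0 hm0 hA hm⟩
  have hnorm : Algebra.norm ℚ (C'.u : K) ≠ 0 := Algebra.norm_ne_zero_iff.mpr (C'.u).ne_zero
  have hud : (Cd.u : ℚ) ≠ 0 := (Cd.u).ne_zero
  have ha : 0 < (|Algebra.norm ℚ (C'.u : K)| : ℚ) := abs_pos.mpr hnorm
  have hb : 0 < (|(Cd.u : ℚ)| : ℚ) := abs_pos.mpr hud
  have hS'0 : 0 < W'.shaOrder := W'.shaOrder_pos hsha
  have hS0 : 0 < W.shaOrder := W.shaOrder_pos ‹Finite W.sha›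
  have hSd0 : 0 < Wd.shaOrder := Wd.shaOrder_pos ‹Finite Wd.sha›
  have hT'0 : 0 < W'.tamagawaProduct := W'.tamagawaProduct_pos'
  have hT0 : 0 < W.tamagawaProduct := W.tamagawaProduct_pos'
  have hTd0 : 0 < Wd.tamagawaProduct := Wd.tamagawaProduct_pos'
  have ht'0 : 0 < W'.torsionOrder := W'.torsionOrder_pos_holds
  have ht0 : 0 < W.torsionOrder := W.torsionOrder_pos_holds
  have htd0 : 0 < Wd.torsionOrder := Wd.torsionOrder_pos_holds
  have hn' : 0 < n := Nat.pos_of_ne_zero hn0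
  have hm' : 0 < m := Nat.pos_of_ne_zero hm0
  positivity

end General

/-! ## §2 Imaginary `K`, total rank one -/

section Imaginary

variable (W : WeierstrassCurve ℚ) [W.IsElliptic] (K : Type) [Field K] [NumberField K]
  [IsTotallyComplex K] (Wd : WeierstrassCurve ℚ) [Wd.IsElliptic] (W' : WeierstrassCurve K)
  [W'.IsElliptic]

/-- **`hWR_p` from the odd Tamagawa identity at `p`, TOTAL RANK ONE, IMAGINARY `K`**
(`rank W(ℚ) + rank W_d(ℚ) = 1`; `Ш(W)`, `Ш(W_d)` finite; `p` odd): `n = n_W ∈ {1, 2}` from the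
tree's `realPeriod_mul_realPeriod_quadraticTwist_eq_mul_bsdPeriod`, `m ∈ {1, 4}` from FILE E-1's
`exists_mul_regulator_baseChange_quadratic_of_rank_add_eq_one`, both `p`-adic units. The schema the
rank-one discharges (FILE E-3) instantiate.
[cite: Milne1972ArithmeticAV, §1 Thm. 1 and §2 (through DokchitserDokchitserAnnals2010, §2.1, proof of Thm. 8)]
[cite: GrossZagier1986, V.§2 (p. 311)] -/
theorem milneQuotient_ordp_of_tamagawa_of_rank_add_eq_one (h2 : Module.finrank ℚ K = 2)
    {Cd : VariableChange ℚ} (hWd : Cd • W.quadraticTwist (NumberField.discr K : ℚ) = Wd)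
    {C' : VariableChange K} (hW' : C' • W.baseChange K = W') [Finite W.sha] [Finite Wd.sha]
    (hr : W.mordellWeilRank + Wd.mordellWeilRank = 1) (p : ℕ) [hp : Fact p.Prime] (hp2 : p ≠ 2)
    (hT : padicValRat p (|Algebra.norm ℚ (C'.u : K)| * W'.tamagawaProduct : ℚ) =
      padicValRat p (|(Cd.u : ℚ)| * (W.tamagawaProduct * Wd.tamagawaProduct) : ℚ)) :
    ∃ q : ℚ, 0 < q ∧ padicValRat p q = 0 ∧
      (W'.shaOrder : ℝ) * W'.regulator * W'.bsdPeriod * (W'.tamagawaProduct : ℝ) /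
          (W'.torsionOrder : ℝ) ^ 2 = (q : ℝ) * (W.bsdRHS * Wd.bsdRHS) := by
  obtain ⟨m, hm14, hm⟩ := exists_mul_regulator_baseChange_quadratic_of_rank_add_eq_one W K h2 Wd
    ⟨Cd, hWd⟩ W' ⟨C', hW'⟩ hr
  have hm0 : m ≠ 0 := by rcases hm14 with rfl | rfl <;> norm_num
  have hn0 : (W.baseChange ℝ).numRealComponents ≠ 0 := (W.baseChange ℝ).numRealComponents_pos.ne'
  haveI : Fact (Nat.Prime 2) := ⟨Nat.prime_two⟩
  have h2v : padicValRat p (2 : ℚ) = 0 := by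
    rw [show (2 : ℚ) = ((2 : ℕ) : ℚ) by norm_num, padicValRat.of_nat, padicValNat_primes hp2,
      Nat.cast_zero]
  have hnv : padicValRat p ((W.baseChange ℝ).numRealComponents : ℚ) = 0 := by
    rw [numRealComponents_baseChange_real]
    split_ifs
    · rw [padicValRat.of_nat, padicValNat_primes hp2, Nat.cast_zero]
    · rw [Nat.cast_one, padicValRat.one]
  have hmv : padicValRat p (m : ℚ) = 0 := by
    rcases hm14 with rfl | rfl
    · rw [Nat.cast_one, padicValRat.one]
    · rw [show ((4 : ℕ) : ℚ) = (2 : ℚ) ^ 2 by norm_num, padicValRat.pow, h2v, mul_zero]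
  exact milneQuotient_ordp_of_tamagawa_of_arch_of_regulator W K Wd W' h2 hWd hW' hn0 hm0
    (realPeriod_mul_realPeriod_quadraticTwist_eq_mul_bsdPeriod W K h2) hm p hp2 hnv hmv hT

end Imaginary

end Summit.BirchSwinnertonDyer.Rank1Residual.AdditivePotMult

end
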